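import Literature.Probability.RandomPlanarGeometry.ChordalCurveFamily
import HarnessLib

/-!
# Lattice-similarity covariance of chordal curve families

Topic `Literature/Probability/RandomPlanarGeometry` (definition item
`defn-ChordalFamily.IsLatticeSimilarityCovariant`, for crux `stmt-CriticalPhenomena-1368`, route
SAWRestrictionRigidity of `CriticalPhenomena/SAWScalingLimit`).

A chordal curve family `P : DobrushinDomain → Measure (CurveClass ℂ)` (`ChordalCurveFamily.lean`) is
**similarity covariant** (`ChordalFamily.IsSimilarityCovariant`, Werner 2007 §3.2 condition (1)
restricted to the maps `z ↦ c z + w`, `c ≠ 0`) when `P (φ D) = φ_* (P D)` for every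
orientation-preserving similarity `φ` of the plane. The scaling limit of a model carried by the
square lattice `δℤ²`, `δ → 0`, inherits a priori only the covariance under the symmetries that the
lattices `δℤ²` induce on the plane (Beffara 2008, §2.2: the rotation `Ψ_s` of order `4` is the
symmetry of the square lattice that pins its conformal modulus `α_{T_s} = i`; proof of Prop. 4:
`z ↦ z̄` pushes the lattice picture forward):

* translations `z ↦ z + w`, ALL `w ∈ ℂ` (an axis-parallel `w` lies in `δₙℤ²` along `δₙ = |w| / n`,
  and axis-parallel translations generate `ℂ`);
* dilations `z ↦ r z`, `r > 0` (`(λΩ)_δ = λ · Ω_{δ/λ}`);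
* the rotations `z ↦ i^k z` by multiples of `π / 2` (they preserve `δℤ²`);
* complex conjugation `z ↦ z̄` (it preserves `δℤ²`).

Together these generate the group of maps `z ↦ c z + w` and `z ↦ c z̄ + w` with `c = r · i^k`,
`r > 0`, `k ∈ ℕ`, i.e. `(ℂ ⋊ ℝ₊) ⋊ D₄`. This file defines

* `ChordalFamily.IsLatticeSimilarityCovariant P` — the conjunction of the two hypotheses (v)
  inlined in the route decls `Rigidity` / `AxiomsOfLimit` of SAWRestrictionRigidity, LITERALLY:
  (a) `P (φ D) = φ_* (P D)` for every `φ = similarity c hc w` whose multiplier is a lattice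
  multiplier, `∃ (r : ℝ) (k : ℕ), 0 < r ∧ c = r * I ^ k`; (b) `P (D̄) = conj_* (P D)` for the
  conjugation homeomorphism `Complex.conjLIE.toHomeomorph`
  (`ChordalFamily.isLatticeSimilarityCovariant_iff` is `Iff.rfl` against the inlined text);

and proves the API the item asks for:

* `IsSimilarityCovariant.isLatticeSimilarityCovariant_left`,
  `IsConformallyCovariant.isLatticeSimilarityCovariant_left` — clause (a) follows from full
  similarity covariance, hence (via the tree's `IsConformallyCovariant.isSimilarityCovariant`) from
  conformal covariance; `IsSimilarityCovariant.isLatticeSimilarityCovariant` adds clause (b) as a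
  hypothesis (conjugation is anti-conformal, so (b) is NOT a consequence of conformal covariance);
* the projections / specialisations `IsLatticeSimilarityCovariant.similarity_eq`, `conj_eq`,
  `translation_eq` (`c = 1`), `dilation_eq` (`c = r > 0`), `mul_I_eq` (quarter-turn, `c = i`),
  `neg_one_eq` (half-turn, `c = -1`);
* `exists_eq_ofReal_mul_I_pow_iff` — the lattice multipliers `r · i^k` are exactly the non-zero
  points of the two coordinate axes, `c ≠ 0 ∧ (re c = 0 ∨ im c = 0)`;
* `ChordalFamily.covariant_trans` — covariance under two plane homeomorphisms gives covariance
  under their composite (via the genuine functoriality lemmas `JordanDomain.map_map`,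
  `MarkedDomain.map_map`, `CurveClass.map_homeomorph_trans`), whence
  `IsLatticeSimilarityCovariant.conj_trans_similarity_eq`: covariance under the
  orientation-REVERSING coset `z ↦ c z̄ + w` — so the two clauses do give covariance under the
  whole group `(ℂ ⋊ ℝ₊) ⋊ D₄` described above;
* non-vacuity: `isLatticeSimilarityCovariant_arcFamily`, `isLatticeSimilarityCovariant_tipFamily`
  (the conjugation clause because the boundary arc of `D̄` is `conj ∘` the arc of `D`,
  `MarkedDomain.arcCurve_map`).

## Design notes

* The definition is stated for the generators separately (lattice similarities; conjugation),
  exactly as the route inlines it; covariance under composites is a THEOREM (`covariant_trans`),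
  not part of the definition, so that assuming `IsLatticeSimilarityCovariant` is never stronger
  than assuming the two inlined clauses.
* All translations are included although a fixed lattice `δℤ²` is only `δℤ²`-periodic: the
  notion concerns the `δ → 0` limit along arbitrary sequences `δₙ → 0` (Beffara 2008 §1.2,
  "scaling limit"), under which every axis-parallel translation is a lattice translation for a
  suitable sequence of meshes; this is the form the requester specified.
* Nothing here is specific to the self-avoiding walk: the same symmetry group is inherited by
  every `δℤ²` scaling limit (percolation and Ising interfaces, loop-erased walk, UST Peano curve).

## Sources

W. Werner, *Lectures on two-dimensional critical percolation*, IAS/Park City (2007),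
arXiv:0710.0856, §3.2 condition (1) and the remark "take a symmetric scale-invariant measure on
paths in `ℍ` … and map it conformally" (p. 19 of the arXiv version); V. Beffara, *Is critical 2D
percolation universal?*, Progr. Probab. 60 (2008) 31–58, arXiv:0708.3908, §2.1 Prop. 4 (and its
proof: `φ_{-i} : z ↦ z̄`), §2.2 (symmetry `Ψ_s` of order `4` of the square lattice forces
`α_{T_s} = i`).

## Mathlib / tree

Mathlib: `Complex.conjLIE` (`ℂ ≃ₗᵢ[ℝ] ℂ`), `LinearIsometryEquiv.toHomeomorph`, `Homeomorph.trans`,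
`Homeomorph.coe_trans`, `Measure.map_map`, `Measure.map_dirac'`. Tree: `ChordalFamily`,
`IsSimilarityCovariant`, `IsConformallyCovariant(.isSimilarityCovariant)`, `similarity`,
`MarkedDomain.map`, `MarkedDomain.arcCurve_map`, `arcFamily`, `tipFamily`,
`measurable_curveClassMap_similarity` (ChordalCurveFamily); `CurveClass.map`, `map_mk`,
`lipschitzWith_map`, `surjective_mk` (CurveSpace). Searched (`lean search`): no
`LatticeSimilarity|conjLIE.toHomeomorph` covariance notion in Literature; `CurveClass.map_map`
exists in `LoopSpaceMaps` (not imported here to keep the import closure of chordal families free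
of loop-ensemble material; the two-line functoriality argument is re-proved for homeomorphisms as
`CurveClass.map_homeomorph_trans`).
-/

noncomputable section

open Set MeasureTheory Topology Filter
open scoped ComplexConjugate

namespace Literature.Probability.RandomPlanarGeometry

/-! ### Functoriality of the image constructions -/

namespace JordanDomain

/-- Two Jordan domains with the same carrier and the same boundary loop are equal (all other
fields are proofs). [folklore] -/
@[ext] theorem ext {D₁ D₂ : JordanDomain} (hc : D₁.carrier = D₂.carrier)
    (hb : D₁.boundary = D₂.boundary) : D₁ = D₂ := by
  cases D₁
  cases D₂
  dsimp only at hc hb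
  subst hc
  subst hb
  rfl

/-- Functoriality of the image of a Jordan domain under plane homeomorphisms:
`ψ(φ(D)) = (ψ ∘ φ)(D)`. [folklore] -/
theorem map_map (D : JordanDomain) (φ ψ : ℂ ≃ₜ ℂ) :
    (D.map φ).map ψ = D.map (φ.trans ψ) :=
  ext (by rw [carrier_map, carrier_map, carrier_map, Set.image_image]; rfl) rfl

end JordanDomain

namespace MarkedDomain

variable {n : ℕ}

/-- Two marked domains with the same underlying Jordan domain (carrier and boundary loop) and the
same boundary parameters of the marked points are equal. [folklore] -/
@[ext] theorem ext {D₁ D₂ : MarkedDomain n} (h : D₁.toJordanDomain = D₂.toJordanDomain)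
    (hm : D₁.mark = D₂.mark) : D₁ = D₂ := by
  cases D₁
  cases D₂
  dsimp only at h hm
  subst h
  subst hm
  rfl

/-- Functoriality of the image of a marked domain under plane homeomorphisms:
`ψ(φ(D; x₁, …, xₙ)) = (ψ ∘ φ)(D; x₁, …, xₙ)`. [folklore] -/
theorem map_map (D : MarkedDomain n) (φ ψ : ℂ ≃ₜ ℂ) :
    (D.map φ).map ψ = D.map (φ.trans ψ) :=
  ext (D.toJordanDomain.map_map φ ψ) rfl

end MarkedDomain

/-- Push-forward of curve classes along a composite of plane homeomorphisms is the composite of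
the push-forwards (functoriality of `CurveClass.map`, Aizenman–Burchard 1999 §2.1, specialised).
[folklore] -/
theorem CurveClass.map_homeomorph_trans (φ ψ : ℂ ≃ₜ ℂ) :
    CurveClass.map ((φ.trans ψ : ℂ ≃ₜ ℂ) : C(ℂ, ℂ)) =
      CurveClass.map (ψ : C(ℂ, ℂ)) ∘ CurveClass.map (φ : C(ℂ, ℂ)) := by
  funext c
  obtain ⟨γ, rfl⟩ := CurveClass.surjective_mk c
  rfl

/-! ### Complex conjugation as a plane homeomorphism -/

/-- The conjugation homeomorphism `Complex.conjLIE.toHomeomorph` is `z ↦ z̄` on points. [folklore] -/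
theorem conjLIE_toHomeomorph_apply (z : ℂ) :
    Complex.conjLIE.toHomeomorph z = conj z := rfl

/-- The orientation-reversing lattice similarity "conjugate, then apply `z ↦ c z + w`" is
`z ↦ c z̄ + w` on points. [folklore] -/
theorem conjLIE_toHomeomorph_trans_similarity_apply (c : ℂ) (hc : c ≠ 0) (w z : ℂ) :
    (Complex.conjLIE.toHomeomorph.trans (similarity c hc w)) z = c * conj z + w := rfl

/-- Complex conjugation, as a continuous self-map of the plane, is `1`-Lipschitz. [folklore] -/
theorem lipschitzWith_conjLIE_toHomeomorph :
    LipschitzWith 1 ((Complex.conjLIE.toHomeomorph : ℂ ≃ₜ ℂ) : C(ℂ, ℂ)) :=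
  Complex.conjLIE.lipschitz

/-- Push-forward of curve classes along complex conjugation is Borel measurable (it is
`1`-Lipschitz, `CurveClass.lipschitzWith_map`). [folklore] -/
theorem measurable_curveClassMap_conj :
    Measurable (CurveClass.map ((Complex.conjLIE.toHomeomorph : ℂ ≃ₜ ℂ) : C(ℂ, ℂ))) :=
  (CurveClass.lipschitzWith_map lipschitzWith_conjLIE_toHomeomorph).continuous.measurable

/-! ### Lattice multipliers `r · i^k` -/

/-- The multipliers `c = r · i^k` (`r > 0`, `k ∈ ℕ`) of the orientation-preserving similarities
induced by the square lattice (dilations composed with quarter-turns) are exactly the non-zero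
complex numbers lying on one of the two coordinate axes. [folklore] -/
theorem exists_eq_ofReal_mul_I_pow_iff {c : ℂ} :
    (∃ (r : ℝ) (k : ℕ), 0 < r ∧ c = (r : ℂ) * Complex.I ^ k) ↔
      c ≠ 0 ∧ (c.re = 0 ∨ c.im = 0) := by
  constructor
  · rintro ⟨r, k, hr, rfl⟩
    refine ⟨mul_ne_zero (Complex.ofReal_ne_zero.2 hr.ne') (pow_ne_zero _ Complex.I_ne_zero), ?_⟩
    induction k with
    | zero => exact Or.inr (by simp)
    | succ k ih =>
      rw [pow_succ, ← mul_assoc]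
      rcases ih with h | h
      · right
        rw [Complex.mul_im, h, Complex.I_re, zero_mul, mul_zero, add_zero]
      · left
        rw [Complex.mul_re, h, Complex.I_im, zero_mul, sub_zero, Complex.I_re, mul_zero]
  · rintro ⟨hc, h | h⟩
    · have him : c.im ≠ 0 := fun him => hc (Complex.ext h him)
      have h3 : Complex.I ^ 3 = -Complex.I := by
        rw [pow_succ, Complex.I_sq]; ring
      rcases lt_or_gt_of_ne him with hlt | hgt
      · refine ⟨-c.im, 3, by linarith, ?_⟩
        rw [h3]
        apply Complex.ext <;> simp [h]
      · refine ⟨c.im, 1, hgt, ?_⟩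
        apply Complex.ext <;> simp [h]
    · have hre : c.re ≠ 0 := fun hre => hc (Complex.ext hre h)
      rcases lt_or_gt_of_ne hre with hlt | hgt
      · refine ⟨-c.re, 2, by linarith, ?_⟩
        apply Complex.ext <;> simp [h]
      · refine ⟨c.re, 0, hgt, ?_⟩
        apply Complex.ext <;> simp [h]

namespace ChordalFamily

variable {P : ChordalFamily}

/-! ### Composition of covariances -/

/-- **Covariances compose.** If the chordal family `P` is covariant under the plane
homeomorphisms `φ` and `ψ` (`P (φ D) = φ_* (P D)` for all Dobrushin domains `D`, and likewise for
`ψ`; both push-forwards Borel on curve classes), then it is covariant under `ψ ∘ φ`: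
`MarkedDomain.map_map`, `Measure.map_map` and functoriality of `CurveClass.map`. [folklore] -/
theorem covariant_trans {φ ψ : ℂ ≃ₜ ℂ}
    (hφm : Measurable (CurveClass.map (φ : C(ℂ, ℂ))))
    (hψm : Measurable (CurveClass.map (ψ : C(ℂ, ℂ))))
    (hφ : ∀ D : DobrushinDomain, P (D.map φ) = (P D).map (CurveClass.map (φ : C(ℂ, ℂ))))
    (hψ : ∀ D : DobrushinDomain, P (D.map ψ) = (P D).map (CurveClass.map (ψ : C(ℂ, ℂ))))
    (D : DobrushinDomain) :
    P (D.map (φ.trans ψ)) = (P D).map (CurveClass.map ((φ.trans ψ : ℂ ≃ₜ ℂ) : C(ℂ, ℂ))) := by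
  rw [← MarkedDomain.map_map, hψ, hφ, Measure.map_map hψm hφm, CurveClass.map_homeomorph_trans]

/-! ### The definition -/

/-- **Lattice-similarity covariance** of a chordal curve family `P`: covariance under the
symmetry group that the square lattices `δℤ²`, `δ → 0`, induce on the plane, as the conjunction
of the two clauses inlined in route SAWRestrictionRigidity (`Rigidity`, `AxiomsOfLimit`,
hypotheses (v)):

* for every Dobrushin domain `D`, every `w ∈ ℂ` and every LATTICE MULTIPLIER `c = r · i^k`
  (`r > 0` a dilation factor, `i^k` a rotation by a multiple of `π/2`),
  `P (φ D) = φ_* (P D)` for the similarity `φ = similarity c hc w : z ↦ c z + w` — Werner's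
  condition (1) (Werner 2007 §3.2), i.e. the tree's `IsSimilarityCovariant`, RESTRICTED from all
  `c ≠ 0` to the multipliers `r · i^k`;
* for every Dobrushin domain `D`, `P (D̄) = conj_* (P D)` for complex conjugation
  `Complex.conjLIE.toHomeomorph : z ↦ z̄` (the reflection symmetry of `ℤ²`; cf. Werner's
  condition (3) and Beffara 2008, proof of Prop. 4, `φ_{-i} : z ↦ z̄`).

By `covariant_trans` the two clauses give covariance under the whole group of maps
`z ↦ c z + w`, `z ↦ c z̄ + w` (`c = r i^k`), i.e. `(ℂ ⋊ ℝ₊) ⋊ D₄` — exactly the symmetry a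
scaling limit along `δℤ²` inherits (Beffara 2008 §2.2: the order-`4` rotation `Ψ_s` is the
symmetry of the square lattice, pinning its modulus `α_{T_s} = i`); full similarity / conformal
covariance is what route SAWRestrictionRigidity sets out to DERIVE from it.
[cite: Werner2007, §3.2 (1)] -/
def IsLatticeSimilarityCovariant (P : ChordalFamily) : Prop :=
  (∀ (D : DobrushinDomain) (c : ℂ) (hc : c ≠ 0) (w : ℂ),
      (∃ (r : ℝ) (k : ℕ), 0 < r ∧ c = (r : ℂ) * Complex.I ^ k) →
        P (D.map (similarity c hc w)) =
          (P D).map (CurveClass.map (similarity c hc w : C(ℂ, ℂ)))) ∧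
    ∀ D : DobrushinDomain,
      P (D.map Complex.conjLIE.toHomeomorph) =
        (P D).map (CurveClass.map (Complex.conjLIE.toHomeomorph : C(ℂ, ℂ)))

/-- Unfolding `IsLatticeSimilarityCovariant`: literally the conjunction of the two clauses
inlined in route SAWRestrictionRigidity (`Rigidity`, `AxiomsOfLimit`). [folklore] -/
theorem isLatticeSimilarityCovariant_iff (P : ChordalFamily) :
    P.IsLatticeSimilarityCovariant ↔
      (∀ (D : DobrushinDomain) (c : ℂ) (hc : c ≠ 0) (w : ℂ),
          (∃ (r : ℝ) (k : ℕ), 0 < r ∧ c = (r : ℂ) * Complex.I ^ k) →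
            P (D.map (similarity c hc w)) =
              (P D).map (CurveClass.map (similarity c hc w : C(ℂ, ℂ)))) ∧
        ∀ D : DobrushinDomain,
          P (D.map Complex.conjLIE.toHomeomorph) =
            (P D).map (CurveClass.map (Complex.conjLIE.toHomeomorph : C(ℂ, ℂ))) :=
  Iff.rfl

/-! ### Projections and specialisations -/

/-- The similarity clause: covariance under `z ↦ c z + w` for a lattice multiplier `c = r i^k`.
[cite: Werner2007, §3.2 (1)] -/
theorem IsLatticeSimilarityCovariant.similarity_eq (h : P.IsLatticeSimilarityCovariant)
    (D : DobrushinDomain) {c : ℂ} (hc : c ≠ 0) (w : ℂ)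
    (hcm : ∃ (r : ℝ) (k : ℕ), 0 < r ∧ c = (r : ℂ) * Complex.I ^ k) :
    P (D.map (similarity c hc w)) = (P D).map (CurveClass.map (similarity c hc w : C(ℂ, ℂ))) :=
  h.1 D c hc w hcm

/-- The conjugation clause: `P (D̄) = conj_* (P D)`. [folklore] -/
theorem IsLatticeSimilarityCovariant.conj_eq (h : P.IsLatticeSimilarityCovariant)
    (D : DobrushinDomain) :
    P (D.map Complex.conjLIE.toHomeomorph) =
      (P D).map (CurveClass.map (Complex.conjLIE.toHomeomorph : C(ℂ, ℂ))) :=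
  h.2 D

/-- Translation covariance (`c = 1 = 1 · i⁰`): `P (D + w) = (· + w)_* (P D)`. [folklore] -/
theorem IsLatticeSimilarityCovariant.translation_eq (h : P.IsLatticeSimilarityCovariant)
    (D : DobrushinDomain) (hc : (1 : ℂ) ≠ 0) (w : ℂ) :
    P (D.map (similarity 1 hc w)) = (P D).map (CurveClass.map (similarity 1 hc w : C(ℂ, ℂ))) :=
  h.1 D 1 hc w ⟨1, 0, one_pos, by simp⟩

/-- Dilation covariance (`c = r = r · i⁰`, `r > 0`): `P (r D + w) = (r · + w)_* (P D)` — the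
scale covariance `(λΩ)_δ = λ · Ω_{δ/λ}` of a lattice scaling limit. [folklore] -/
theorem IsLatticeSimilarityCovariant.dilation_eq (h : P.IsLatticeSimilarityCovariant)
    (D : DobrushinDomain) {r : ℝ} (hr : 0 < r) (hc : (r : ℂ) ≠ 0) (w : ℂ) :
    P (D.map (similarity r hc w)) = (P D).map (CurveClass.map (similarity r hc w : C(ℂ, ℂ))) :=
  h.1 D r hc w ⟨r, 0, hr, by simp⟩

/-- Quarter-turn covariance (`c = i = 1 · i¹`): the order-`4` rotational symmetry of `ℤ²`
(Beffara 2008 §2.2, `Ψ_s`). [cite: Beffara2008Universal, §2.2] -/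
theorem IsLatticeSimilarityCovariant.mul_I_eq (h : P.IsLatticeSimilarityCovariant)
    (D : DobrushinDomain) (hc : Complex.I ≠ 0) (w : ℂ) :
    P (D.map (similarity Complex.I hc w)) =
      (P D).map (CurveClass.map (similarity Complex.I hc w : C(ℂ, ℂ))) :=
  h.1 D Complex.I hc w ⟨1, 1, one_pos, by simp⟩

/-- Half-turn covariance (`c = -1 = 1 · i²`): the central symmetry of `ℤ²`. [folklore] -/
theorem IsLatticeSimilarityCovariant.neg_one_eq (h : P.IsLatticeSimilarityCovariant)
    (D : DobrushinDomain) (hc : (-1 : ℂ) ≠ 0) (w : ℂ) :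
    P (D.map (similarity (-1) hc w)) =
      (P D).map (CurveClass.map (similarity (-1) hc w : C(ℂ, ℂ))) :=
  h.1 D (-1) hc w ⟨1, 2, one_pos, by simp⟩

/-- Covariance under the orientation-REVERSING lattice similarities `z ↦ c z̄ + w` (`c = r i^k`;
conjugate first, then apply `similarity c hc w`), by composing the two clauses
(`covariant_trans`): together with `similarity_eq` this is covariance under the full group
`(ℂ ⋊ ℝ₊) ⋊ D₄` of plane symmetries induced by `δℤ²`, `δ → 0`. [cite: Beffara2008Universal, §2.2] -/
theorem IsLatticeSimilarityCovariant.conj_trans_similarity_eq (h : P.IsLatticeSimilarityCovariant)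
    (D : DobrushinDomain) {c : ℂ} (hc : c ≠ 0) (w : ℂ)
    (hcm : ∃ (r : ℝ) (k : ℕ), 0 < r ∧ c = (r : ℂ) * Complex.I ^ k) :
    P (D.map (Complex.conjLIE.toHomeomorph.trans (similarity c hc w))) =
      (P D).map (CurveClass.map
        ((Complex.conjLIE.toHomeomorph.trans (similarity c hc w) : ℂ ≃ₜ ℂ) : C(ℂ, ℂ))) :=
  covariant_trans measurable_curveClassMap_conj (measurable_curveClassMap_similarity c hc w)
    h.2 (fun D => h.1 D c hc w hcm) D

/-! ### From similarity / conformal covariance -/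

/-- Full similarity covariance (Werner 2007 §3.2 (1) for all similarities) gives the similarity
clause of lattice-similarity covariance (restrict to the multipliers `r i^k`).
[cite: Werner2007, §3.2 (1)] -/
theorem IsSimilarityCovariant.isLatticeSimilarityCovariant_left (h : P.IsSimilarityCovariant) :
    ∀ (D : DobrushinDomain) (c : ℂ) (hc : c ≠ 0) (w : ℂ),
      (∃ (r : ℝ) (k : ℕ), 0 < r ∧ c = (r : ℂ) * Complex.I ^ k) →
        P (D.map (similarity c hc w)) =
          (P D).map (CurveClass.map (similarity c hc w : C(ℂ, ℂ))) :=
  fun D c hc w _ => h D c hc w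

/-- A similarity covariant family that is also conjugation covariant is lattice-similarity
covariant. [folklore] -/
theorem IsSimilarityCovariant.isLatticeSimilarityCovariant (h : P.IsSimilarityCovariant)
    (hconj : ∀ D : DobrushinDomain, P (D.map Complex.conjLIE.toHomeomorph) =
      (P D).map (CurveClass.map (Complex.conjLIE.toHomeomorph : C(ℂ, ℂ)))) :
    P.IsLatticeSimilarityCovariant :=
  ⟨h.isLatticeSimilarityCovariant_left, hconj⟩

/-- Conformal covariance gives the similarity clause of lattice-similarity covariance (through
the tree's `IsConformallyCovariant.isSimilarityCovariant`). It does NOT give the conjugation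
clause: `z ↦ z̄` is anti-conformal. [cite: Werner2007, §3.2 (1)] -/
theorem IsConformallyCovariant.isLatticeSimilarityCovariant_left (h : P.IsConformallyCovariant) :
    ∀ (D : DobrushinDomain) (c : ℂ) (hc : c ≠ 0) (w : ℂ),
      (∃ (r : ℝ) (k : ℕ), 0 < r ∧ c = (r : ℂ) * Complex.I ^ k) →
        P (D.map (similarity c hc w)) =
          (P D).map (CurveClass.map (similarity c hc w : C(ℂ, ℂ))) :=
  h.isSimilarityCovariant.isLatticeSimilarityCovariant_left

/-- A conformally covariant family that is also conjugation covariant is lattice-similarity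
covariant. [folklore] -/
theorem IsConformallyCovariant.isLatticeSimilarityCovariant (h : P.IsConformallyCovariant)
    (hconj : ∀ D : DobrushinDomain, P (D.map Complex.conjLIE.toHomeomorph) =
      (P D).map (CurveClass.map (Complex.conjLIE.toHomeomorph : C(ℂ, ℂ)))) :
    P.IsLatticeSimilarityCovariant :=
  h.isSimilarityCovariant.isLatticeSimilarityCovariant hconj

/-! ### Non-vacuity -/

/-- `arcFamily` (Dirac mass on the boundary arc `(ab)`) is lattice-similarity covariant: it is
similarity covariant, and the arc of the conjugated domain `D̄` is `conj ∘` the arc of `D`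
(`MarkedDomain.arcCurve_map`). [folklore] -/
theorem isLatticeSimilarityCovariant_arcFamily : arcFamily.IsLatticeSimilarityCovariant := by
  refine isSimilarityCovariant_arcFamily.isLatticeSimilarityCovariant fun D => ?_
  rw [arcFamily, arcFamily, Measure.map_dirac' measurable_curveClassMap_conj, CurveClass.map_mk,
    MarkedDomain.arcCurve_map]

/-- `tipFamily` (Dirac mass on the constant curve at `a`) is lattice-similarity covariant.
[folklore] -/
theorem isLatticeSimilarityCovariant_tipFamily : tipFamily.IsLatticeSimilarityCovariant := by
  refine isSimilarityCovariant_tipFamily.isLatticeSimilarityCovariant fun D => ?_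
  rw [tipFamily, tipFamily, Measure.map_dirac' measurable_curveClassMap_conj, CurveClass.map_mk]
  rfl

end ChordalFamily

end Literature.Probability.RandomPlanarGeometry
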